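import Literature.NumberTheory.EllipticCurves.PAdicLFunctionInvolutionProofs
import HarnessLib

/-!
# The characters of `Γ` with prescribed value at `γ`, values in ANY commutative ring — proofs

Topic `NumberTheory/EllipticCurves`; namespace `Literature.NumberTheory.EllipticCurves`. THEOREMS ONLY (no definition, no named fact, no `sorry`).
The tree's `exists_character_apply_cyclotomicGenerator_eq` (`CyclotomicInterpolantUniquenessProofs.lean`) constructs, for a `p`-power root of
unity `ζ ∈ ℂ_p` of exact order `p^{j+1}`, a primitive even Dirichlet character `χ` of conductor `p^{j+1+e₀}` and `p`-power order with
`χ(γ) = ζ` (`γ = cyclotomicGenerator p = 1 + p^{e₀}`, `e₀ = cyclotomicExponent p`). Its proof uses nothing about `ℂ_p`; this file records the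
same construction for `ζ` in an arbitrary commutative ring `F` (needed for `F = ℂ`: the complex characters of `Γ_n` are parametrised by the
primitive `p^n`-th roots of unity `χ(γ)`, Mazur–Tate–Teitelbaum §I.13; Washington §7.2), proof VERBATIM that of the tree theorem with `ℂ_p`
replaced by `F`: `(ℤ/p^{j+1+e₀})^× = μ_τ × ⟨γ⟩` (`classMap_injective`, `card_classDomain`, `classMap_mul`), `χ(η γ^s) := ζ^s`.

* `exists_dirichletCharacter_apply_cyclotomicGenerator_eq` — `∃ χ : DirichletCharacter F (p^{j+1+e₀})`, primitive, even, of `p`-power order, `χ(γ) = ζ`.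

References: [MazurTateTeitelbaum1986Invent] §I.13; [Washington1997] §7.2.
-/

noncomputable section

open Polynomial

namespace Literature.NumberTheory.EllipticCurves

variable {p : ℕ} [Fact p.Prime]

/-- **Every `p`-power root of unity is `χ(γ)` for a character `χ` of `Γ`, values in any commutative ring `F`.** For `ζ ∈ F` of exact
order `p^{j+1}` there is a primitive even Dirichlet character `χ` of conductor `p^{j+1+e₀}` and `p`-power order with values in `F` such that
`χ(γ) = ζ`: writing `(ℤ/p^{j+1+e₀})^× = μ_τ × ⟨γ⟩`, `γ` of order `p^{j+1}`, set `χ(η γ^s) = ζ^s`; even (`-1 ∈ μ_τ`), of order dividing `p^{j+1}`,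
primitive since a character through `p^{j+e₀}` kills `γ^{p^j}` whereas `ζ^{p^j} ≠ 1`. (The tree's `exists_character_apply_cyclotomicGenerator_eq` is the
case `F = ℂ_p`, same proof.) [cite: MazurTateTeitelbaum1986Invent, §I.13] [cite: Washington1997, §7.2] -/
theorem exists_dirichletCharacter_apply_cyclotomicGenerator_eq {F : Type*} [CommRing F] (j : ℕ) {ζ : F}
    (hζ : IsPrimitiveRoot ζ (p ^ (j + 1))) :
    ∃ χ : DirichletCharacter F (p ^ (j + 1 + cyclotomicExponent p)),
      χ.IsPrimitive ∧ χ.Even ∧ (∃ i : ℕ, orderOf χ = p ^ i) ∧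
        χ (cyclotomicGenerator p : ZMod (p ^ (j + 1 + cyclotomicExponent p))) = ζ := by
  classical
  have hp : p.Prime := Fact.out
  haveI := neZero_torsionOrder p
  haveI := Fintype.ofFinite (rootsOfUnity (torsionOrder p) ℤ_[p])
  haveI : NeZero (p ^ (j + 1)) := ⟨pow_ne_zero _ hp.ne_zero⟩
  haveI : NeZero (p ^ (j + 1 + cyclotomicExponent p)) := ⟨pow_ne_zero _ hp.ne_zero⟩
  haveI : Fact (1 < p ^ (j + 1)) := ⟨Nat.one_lt_pow (by omega) hp.one_lt⟩
  -- the bijection `Φ : μ_τ × ℤ/p^{j+1} → (ℤ/p^{j+1+e₀})^×`, `(η, s) ↦ η γ^s`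
  set Φ : rootsOfUnity (torsionOrder p) ℤ_[p] × ZMod (p ^ (j + 1)) →
      (ZMod (p ^ (j + 1 + cyclotomicExponent p)))ˣ := fun x ↦ (isUnit_classMap p (j + 1) x).unit
    with hΦ_def
  have hΦval : ∀ x, (Φ x : ZMod (p ^ (j + 1 + cyclotomicExponent p))) =
      PadicInt.toZModPow (j + 1 + cyclotomicExponent p) ((x.1 : ℤ_[p]ˣ) : ℤ_[p]) *
        (cyclotomicGenerator p : ZMod (p ^ (j + 1 + cyclotomicExponent p))) ^ x.2.val := fun x ↦
    IsUnit.unit_spec _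
  have hΦinj : Function.Injective Φ := fun x y hxy ↦ classMap_injective p (j + 1) (by
    have h := congr_arg Units.val hxy
    rwa [hΦval, hΦval] at h)
  have hΦbij : Function.Bijective Φ :=
    (Fintype.bijective_iff_injective_and_card Φ).mpr ⟨hΦinj, card_classDomain p (j + 1)⟩
  have hΦmul : ∀ x y, Φ (x.1 * y.1, x.2 + y.2) = Φ x * Φ y := fun x y ↦ by
    ext
    rw [Units.val_mul, hΦval, hΦval, hΦval]
    exact classMap_mul p (j + 1) x.1 y.1 x.2 y.2
  set E := Equiv.ofBijective Φ hΦbij with hE_def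
  have hE : ∀ x, E x = Φ x := fun x ↦ rfl
  have hEsymm_mul : ∀ u v, E.symm (u * v) = ((E.symm u).1 * (E.symm v).1, (E.symm u).2 + (E.symm v).2) :=
    fun u v ↦ E.injective (by
      rw [Equiv.apply_symm_apply, hE, hΦmul, ← hE, ← hE, Equiv.apply_symm_apply,
        Equiv.apply_symm_apply])
  have hEsymm_one : E.symm 1 = (1, 0) := E.injective (by
    rw [Equiv.apply_symm_apply, hE]
    ext
    rw [hΦval, Units.val_one]
    exact (classMap_one p (j + 1)).symm)
  -- `ζ` as a unit
  have hζ1 : ζ ^ p ^ (j + 1) = 1 := hζ.pow_eq_one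
  set ζu : Fˣ := (hζ.isUnit (pow_pos hp.pos _).ne').unit with hζu_def
  have hζu : (ζu : F) = ζ := IsUnit.unit_spec _
  have hζu1 : ζu ^ p ^ (j + 1) = 1 := by
    ext
    rw [Units.val_pow_eq_pow_val, hζu, hζ1, Units.val_one]
  -- the character `χ(η γ^s) = ζ^s`
  let f : (ZMod (p ^ (j + 1 + cyclotomicExponent p)))ˣ →* Fˣ :=
    { toFun := fun u ↦ ζu ^ (E.symm u).2.val
      map_one' := by rw [hEsymm_one, ZMod.val_zero, pow_zero]
      map_mul' := fun u v ↦ by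
        rw [hEsymm_mul, ZMod.val_add, ← pow_eq_pow_mod _ hζu1, pow_add] }
  have hf : ∀ u, f u = ζu ^ (E.symm u).2.val := fun u ↦ rfl
  set χ : DirichletCharacter F (p ^ (j + 1 + cyclotomicExponent p)) := MulChar.ofUnitHom f
    with hχ_def
  have hχapply : ∀ x, χ ((Φ x : (ZMod (p ^ (j + 1 + cyclotomicExponent p)))ˣ) :
      ZMod (p ^ (j + 1 + cyclotomicExponent p))) = ζ ^ x.2.val := fun x ↦ by
    rw [hχ_def, MulChar.ofUnitHom_coe, hf, ← hE, Equiv.symm_apply_apply, Units.val_pow_eq_pow_val,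
      hζu]
  -- `γ = Φ (1, 1)`
  have hγ : (Φ (1, 1) : ZMod (p ^ (j + 1 + cyclotomicExponent p))) =
      (cyclotomicGenerator p : ZMod (p ^ (j + 1 + cyclotomicExponent p))) := by
    rw [hΦval, OneMemClass.coe_one, Units.val_one, map_one, one_mul, ZMod.val_one, pow_one]
  have hχγ : χ (cyclotomicGenerator p : ZMod (p ^ (j + 1 + cyclotomicExponent p))) = ζ := by
    rw [← hγ, hχapply, ZMod.val_one, pow_one]
  refine ⟨χ, ?_, ?_, ?_, hχγ⟩
  · -- primitive: otherwise `χ` factors through `p^{j+e₀}`, which kills `γ^{p^j}`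
    by_contra hprim
    have hcd : χ.conductor ∣ p ^ (j + 1 + cyclotomicExponent p) := χ.conductor_dvd_level
    obtain ⟨i, hi, hci⟩ := (Nat.dvd_prime_pow hp).mp hcd
    have hi' : i ≤ j + cyclotomicExponent p := by
      rcases Nat.lt_or_ge i (j + 1 + cyclotomicExponent p) with h | h
      · omega
      · exact absurd ((le_antisymm hi h) ▸ hci) hprim
    have hle : j + cyclotomicExponent p ≤ j + 1 + cyclotomicExponent p := by omega
    have hd : p ^ (j + cyclotomicExponent p) ∣ p ^ (j + 1 + cyclotomicExponent p) :=
      pow_dvd_pow p hle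
    have hft : χ.FactorsThrough (p ^ (j + cyclotomicExponent p)) :=
      χ.factorsThrough_conductor.mono χ (hci ▸ pow_dvd_pow p hi') hd
    have hker := (DirichletCharacter.factorsThrough_iff_ker_unitsMap hd).mp hft
    -- `u = γ^{p^j}` lies in the kernel of reduction
    have hu : (Φ (1, 1)) ^ p ^ j ∈ (ZMod.unitsMap hd).ker := by
      rw [MonoidHom.mem_ker, map_pow]
      ext
      rw [Units.val_pow_eq_pow_val, ZMod.unitsMap_def, Units.coe_map, hγ, MonoidHom.coe_coe,
        map_natCast, ← orderOf_cyclotomicGenerator p j, pow_orderOf_eq_one, Units.val_one]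
    have h1 := hker hu
    rw [MonoidHom.mem_ker, Units.ext_iff, MulChar.coe_toUnitHom, Units.val_pow_eq_pow_val, map_pow,
      hγ, hχγ, Units.val_one] at h1
    exact hζ.pow_ne_one_of_pos_of_lt (pow_pos hp.pos j).ne' (Nat.pow_lt_pow_right hp.one_lt (by omega)) h1
  · -- even: `-1 = Φ (-1, 0)`
    have hm1 : (Φ (⟨-1, neg_one_mem_rootsOfUnity_torsionOrder p⟩, 0) :
        ZMod (p ^ (j + 1 + cyclotomicExponent p))) = -1 := by
      rw [hΦval]
      exact classMap_neg_one p (j + 1)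
    show χ (-1) = 1
    rw [← hm1, hχapply, ZMod.val_zero, pow_zero]
  · -- `p`-power order: `χ^{p^{j+1}} = 1`
    have hpow : χ ^ p ^ (j + 1) = 1 := by
      refine MulChar.ext fun a ↦ ?_
      obtain ⟨x, rfl⟩ := hΦbij.2 a
      rw [MulChar.pow_apply_coe, MulChar.one_apply_coe, hχapply, ← pow_mul, mul_comm, pow_mul, hζ1,
        one_pow]
    obtain ⟨i, -, hi⟩ := (Nat.dvd_prime_pow hp).mp (orderOf_dvd_of_pow_eq_one hpow)
    exact ⟨i, hi⟩

end Literature.NumberTheory.EllipticCurves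

end
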